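import Summits.Ventures.HodgeRepro0.P6AokiQuotientLevel84Data1

/-!
# Aoki's quotient `B_q/(S_q + D_q)` at the level q = 84 — kernel certificate (part 2 of 2)

The facts `fact_*` (each one `decide +kernel`) and the theorem `main` (part 2 of 2).
-/

namespace HodgeRepro0.P6AokiQuotient

namespace L84
/-- level 84: the kernel-decided fact `hbound` of `level_of_decided`. -/
theorem fact_hbound : ∀ es ∈ genEntries 84, ∀ a ∈ es, 1 ≤ a ∧ a ≤ 84 - 1 := by decide +kernel
/-- level 84: the kernel-decided fact `hθ` of `level_of_decided`. -/
theorem fact_htheta : ∀ es ∈ genEntries 84, ∀ t ∈ unitsList 84, (es.map (thetaN 84 t)).sum = 0 := by decide +kernel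
/-- level 84: the kernel-decided fact `hpiv` of `level_of_decided`. -/
theorem fact_hpiv : ∀ i < 71, pivL.getD i 0 < 84 - 1 := by decide +kernel
/-- level 84: the kernel-decided fact `hP` of `level_of_decided`. -/
theorem fact_hP : ∀ j < 12, PL.getD j 0 < 84 - 1 := by decide +kernel
/-- level 84: the kernel-decided fact `hℓ` of `level_of_decided`. -/
theorem fact_hell : ∀ i < 71, ∀ j < 71, (ellL.getD i []).getD (pivL.getD j 0) 0 = if i = j then 1 else 0 := by decide +kernel
/-- level 84: the kernel-decided fact `hY` of `level_of_decided`. -/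
theorem fact_hY : ∀ i < 12, ∀ j < 12, ((List.range (unitsList 84).length).map (fun s => (YL.getD i []).getD s 0 * thetaN 84 ((unitsList 84).getD s 0) (PL.getD j 0 + 1))).sum = if i = j then 336 else 0 := by decide +kernel
/-- level 84: the kernel-decided fact `hcover` of `level_of_decided`. -/
theorem fact_hcover : ∀ a < 84 - 1, (∃ i < 71, pivL.getD i 0 = a) ∨ (∃ j < 12, PL.getD j 0 = a) := by decide +kernel
/-- level 84: the kernel-decided fact `hPinj` of `level_of_decided`. -/
theorem fact_hPinj : ∀ j < 12, ∀ j' < 12, PL.getD j 0 = PL.getD j' 0 → j = j' := by decide +kernel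
/-- level 84: the kernel-decided fact `hβlen` of `level_of_decided`. -/
theorem fact_hbetalen : betaL.length = 3 ∧ ∀ l ∈ betaL, l.length = 84 - 1 := by decide +kernel
/-- level 84: the kernel-decided fact `hℓexpr` of `level_of_decided`. -/
theorem fact_hellexpr : ∀ i < 71, ellL.getD i [] = lincombList (84 - 1) (List.zip (exprG.getD i []) (exprC.getD i [])) (genDenseL ++ betaL) := by decide +kernel
/-- level 84: the kernel-decided fact `hβB` of `level_of_decided`. -/
theorem fact_hbetaB : ∀ j < 3, ∀ t ∈ unitsList 84, ((List.range (84 - 1)).map (fun a => thetaN 84 t (a + 1) * (betaL.getD j []).getD a 0)).sum = 0 := by decide +kernel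
/-- level 84: the kernel-decided fact `hpar` of `level_of_decided`. -/
theorem fact_hpar : ∀ j < 3, ∀ es ∈ genEntries 84, (es.map (fun a => (FL.getD j []).getD (a - 1) 0)).sum % 2 = 0 := by decide +kernel
/-- level 84: the kernel-decided fact `hparβ` of `level_of_decided`. -/
theorem fact_hparbeta : ∀ j < 3, ∀ j' < 3, ((List.range (84 - 1)).map (fun a => (FL.getD j []).getD a 0 * (betaL.getD j' []).getD a 0)).sum % 2 = if j = j' then 1 else 0 := by decide +kernel
/-- level 84: the kernel-decided fact `h2β` of `level_of_decided`. -/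
theorem fact_h2beta : ∀ j < 3, smulL 2 (betaL.getD j []) = lincombList (84 - 1) (List.zip (twoBG.getD j []) (twoBC.getD j [])) genDenseL := by decide +kernel
/-- level 84: the kernel-decided fact `hgu` of `level_of_decided`. -/
theorem fact_hgu : ∀ g ∈ gensL, Nat.gcd g 84 = 1 := by decide +kernel
/-- level 84: the kernel-decided fact `hwords` of `level_of_decided`. -/
theorem fact_hwords : ∀ s < (unitsList 84).length, (unitsList 84).getD s 0 = (wordsL.getD s []).foldl (fun x i => (x * gensL.getD i 1) % 84) 1 := by decide +kernel
/-- level 84: the kernel-decided fact `F1` of `level_of_decided`. -/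
theorem fact_F1 : ∀ t ∈ gensL, ∀ p ∈ oddPrimeDivisors 84, ∀ i ∈ admissible 84 p, ((t * i) % 84 < 84 ∧ admissibleP 84 p ((t * i) % 84) = true) ∧ ((stdEntries 84 p i).map (fun a => (t * a) % 84)).Perm (stdEntries 84 p ((t * i) % 84)) := by decide +kernel
/-- level 84: the kernel-decided fact `F2` of `level_of_decided`. -/
theorem fact_F2 : ∀ t ∈ gensL, ∀ j < (84 - 1) / 2, ∃ j' < (84 - 1) / 2, (([j + 1, 84 - (j + 1)]).map (fun a => (t * a) % 84)).Perm [j' + 1, 84 - (j' + 1)] := by decide +kernel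
/-- level 84: the kernel-decided fact `F3` of `level_of_decided`. -/
theorem fact_F3 : 84 % 2 = 0 → ∀ t ∈ gensL, (t * (84 / 2)) % 84 = 84 / 2 := by decide +kernel
/-- level 84: the kernel-decided fact `F4` of `level_of_decided`. -/
theorem fact_F4 : 84 % 4 = 0 → ∀ t ∈ gensL, ∀ i ∈ admissible 84 2, ((t * i) % 84 < 84 ∧ admissibleP 84 2 ((t * i) % 84) = true) ∧ ((std2Entries 84 i).map (fun a => (t * a) % 84)).Perm (std2Entries 84 ((t * i) % 84)) := by decide +kernel
/-- level 84: the kernel-decided fact `hσβ` of `level_of_decided`. -/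
theorem fact_hsigmabeta : ∀ s < gensL.length, ∀ j < 3, vsubL (sigmaList 84 (gensL.getD s 0) (betaL.getD j [])) (betaL.getD j []) = lincombList (84 - 1) (List.zip ((sigG.getD s []).getD j []) ((sigC.getD s []).getD j [])) genDenseL := by decide +kernel
/-- THE STRUCTURE OF AOKI'S QUOTIENT AT LEVEL 84: `S_84 + D_84 ⊆ B_84`; `B_84 = (S_84 + D_84) + ⟨β_1, …, β_3⟩`; a combination `Σ c_j β_j` lies in `S_84 + D_84` iff every `c_j` is even (so `B_84/(S_84 + D_84) ≅ (ℤ/2)^3`); and `σ_t v − v ∈ S_84 + D_84` for every `v ∈ B_84` and every unit `t` (the group `(ℤ/84)^×` acts trivially on the quotient). -/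
theorem main : SD 84 ≤ B 84 ∧
    B 84 = SD 84 ⊔ Submodule.span ℤ (Set.range (fun j : Fin 3 => toV 83 (betaL.getD j []))) ∧
    (∀ c : Fin 3 → ℤ, (∑ j, c j • toV 83 (betaL.getD j [])) ∈ SD 84 ↔ ∀ j, 2 ∣ c j) ∧
    (∀ v ∈ B 84, ∀ t ∈ unitsList 84, sigmaL 84 t v - v ∈ SD 84) :=
  level_of_decided 84 71 12 3 genDenseL genDense_eq ellL pivL PL YL 336 betaL FL exprG exprC twoBG twoBC gensL wordsL sigG sigC (by decide)
    fact_hbound fact_htheta fact_hpiv fact_hP fact_hell fact_hY fact_hcover fact_hPinj fact_hbetalen fact_hellexpr fact_hbetaB fact_hpar fact_hparbeta fact_h2beta fact_hgu fact_hwords fact_F1 fact_F2 fact_F3 fact_F4 fact_hsigmabeta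
end L84

end HodgeRepro0.P6AokiQuotient
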